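import Summits.QuantumFields.BalabanUV.Beta.GAN24.SrecUnits
import Summits.QuantumFields.BalabanUV.Beta.GAN24.StencilSlotOfShapes
import Summits.QuantumFields.BalabanUV.Beta.GAN24.CubicReadoutDecLift
import Summits.QuantumFields.BalabanUV.Beta.SecondOrderUnits
import Summits.QuantumFields.BalabanUV.Beta.SymmetrisedStepJets

/-!
# `BalabanUV.Beta.FP.PerfectStencilStep` — road «FP» for binder row D1, row **N1-J∞-S** (first half, `LEAVES-FP.md` l.547; owner d1-p3 gen 12):
# THE RESCALED RECURSION STEP OF THE SLOTTED STENCIL FAMILY `SrecOf V H G cE cVH cΛ` IS `j`-INDEPENDENT IN THE ADOPTED UNITS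
# `unitS (sfStep Lc j) (smStep d Lc j)` — `S̃_{j+1} = Φ_S(S̃_j; G̃_j, K̃_{j+1}, K̃_j)` with the `j`-FREE weights `(cE·Lc^{2(d+1)}, cVH, cΛ·Lc^{2(d+1)})`,
# MODULO the block shapes (ShV)(ShH) of the first-order tables (displayed)

HONEST DEPENDENCY (page 1, mandatory): continuum YM on T⁴ ⇐ BetaPertH ∧ nine spine estimates (0/9 proved); BetaPertH ⇐ (D1) ∧ (D4) ∧ CAP+tail;
G-an2-4 gates asym, D1 and NE2/3/4.  HONEST FRAMING (cell contract, verbatim): «discharging `BetaPertH` makes Bałaban's UV stability UNCONDITIONAL —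
a real constructive-QFT result; it is NOT the continuum limit and NOT the Clay problem.»  ABSOLUTE RULE (cell, verbatim): «No internally-minted
statement may enter as a cited fact. Every hypothesis is either kernel-proved in this package or a verbatim quotation of a PUBLISHED theorem with page
reference.»  Nothing is cited; no `def`, no `def … : Prop`; no wall binder instantiated; no existing file touched.

NOT IN PRINT; OUR BOOKKEEPING — [folklore] units algebra over the tree's definitions BY NAME.  HONEST PRIORITY: summand-wise the three identities
are ALREADY kernel-certified by the G-an2-4 row owner `b2b-balaban-gan24-p1`: the cubic summand `GAN24/SrecUnits.unitS_cubicPiece_eq` +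
`cubic_unit_factor` (gen 12), the Lagrange summand `GAN24/StencilSlotLam.unitS_lamPiece_eq` + `lam_unit_factor` (gen 3, with an1's `hessFF` hard-wired),
the border summand `GAN24/StencilSlotVH.unitS_vhPiece_eq` + `vh_unit_factor` (gen 3, with an1's `mfNeg ∘ vhS` hard-wired), whose READING paragraph says
«the WHOLE recursion in units is an affine map with j-free weights driven by K-slot objects only».  NEW HERE (row N1-J∞-S asked for exactly this CHECK):
the SLOTTED assembly for an2's `WardLocusRecursive.SrecOf V H G cE cVH cΛ` (`RecursiveStencilSlot`), i.e. for the (0.4) literal's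
`SymmetrisedStepJets.SsymOf = SrecOf tabs.V tabs.H (Gsym Lc)`, with the two BLOCK-SHAPE LETTERS the slots need DISPLAYED:
(ShV) `V` vanishes on the field–field and multiplier–multiplier blocks; (ShH) `H` vanishes off the field–field block.  LOCATED FINDING: (ShV)(ShH)
hold for an1's VALUES (`vhS` is a field–multiplier kernel, `hessFF` a field–field one — `StencilSlotVH.mfNeg_vhS_inl_inl`, `StencilSlotLam.hessFF_inl_inr`)
but are NOT fields of `SymTables` (which records locality and covariance only); with a field–field component of `V` the rescaled border summand would
carry the `j`-DEPENDENT factor `Lc^{d(j+1)}`.  So: `j`-independence ⇐ (ShV) ∧ (ShH), and nothing weaker is claimed.  OWNER RULING R-FP-43 (journal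
2026-08-21T12:14:22Z): (ShV)(ShH) are TABLE LETTERS of the same class as an2's (V-ff0) — indeed the field–field clause `hVff` IS an2's binder `hV0` of the
root of record `RowD1JointEndSymWard.d1Drift_JsB12Sym_of_an1Shift_wardTables_reflLetters_D1Tel_D1Rep` (p264993) up to the order of the bound variables;
(ShV-mm) `hVmm` and (ShH) `hHfm hHm` are recommended to an1∕an2 as letters next to (V-ff0); displayed here, discharged by nobody yet.

## What is proved (generic `d`; blocking factor `Lc` with `NeZero Lc`; `KStepUnit Lc j = unitK (sfStep Lc j) (smStep d Lc j) (KInvStep Lc j)` BY NAME)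
* §1 `SLam_offFF_*` — `S^Λ` over a field–field table `H` ((ShH)) vanishes off the field–field block (`StencilSlotLam.SLam_entry_zero`);
  `smul_E2_succ_eq_mmRead_KStepUnit` — `(smStep d Lc j)² • E2 d Lc (j+1) = mmRead Lc (KStepUnit Lc j)` (an2's `E2_succ_eq` + an4's `mmRead_unitK`):
  the value Hessian of the `(j+1)`-composite in units IS the `mm`-read of the unit step resolvent of level `j`.
* §2 the three slotted summands at member `j + 1` in the units of level `j + 1`:
  `unitS_borderSlot_eq` ((ShV); weight `cVH`, NO power of `Lc`), `unitS_cubicSlot_eq` (weight `cE·Lc^{2(d+1)}`; `e3OfK` of the unit-rescaled `G j` and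
  of the unit-rescaled previous member), `unitS_lamSlot_eq` ((ShH); weight `cΛ·Lc^{2(d+1)}`; coefficients `lamCoeffK (KStepUnit Lc (j+1)) (mmRead Lc (KStepUnit Lc j)) Lc`).
* §3 **`unitS_SrecOf_succ`** — THE RESCALED STEP:
  `unitS_{j+1} (SrecOf d Lc V H G cE cVH cΛ (j+1)) = fun κ u ↦ (cE·Lc^{2(d+1)}) • e3OfK Lc (unitK_j (G j)) (unitS_j (SrecOf … j)) κ u + cVH • V κ u
   + (cΛ·Lc^{2(d+1)}) • SLam Lc (lamCoeffK (KStepUnit Lc (j+1)) (mmRead Lc (KStepUnit Lc j)) Lc) H κ u`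
  — the right-hand side is ONE map `Φ_S(S; G, K, K′)` of the arguments `(unitS_j S_j; unitK_j G_j, KStepUnit (j+1), KStepUnit j)` in which NO `j` occurs otherwise.
* §4 `unitS_SsymOf_succ` — the instance for the literal's `SsymOf tabs cE cVH cΛ` (`d`, `Lc`, tables, pins generic), (ShV)(ShH) asked of `tabs.V`, `tabs.H`.
Second half (the passage to the limit `j → ∞`: `S∞ = Φ_S(S∞; G∞, K₁, K₁)`) is `FP/PerfectStencilFixedPoint`.  Discharges NO (CONV-C) row and NO table
letter; NOT N2, NOT D1, NOT `BetaPertH`, NOT continuum, NOT Clay.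
-/

noncomputable section

open Finset
open scoped BigOperators
open Literature.MathematicalPhysics.QuantumFieldTheory
open Literature.MathematicalPhysics.QuantumFieldTheory.Balaban1983to89
open Literature.MathematicalPhysics.QuantumFieldTheory.Balaban1983to89.Beta
open ExpKernelCalculus (MKer)
open OneStepResolventKernel (Fib)
open OneStepKernelFamily (KInvStep)
open InterLevelTransport (SLam)
open BalabanStepJetsSucc (E2 mmRead lamCoeffK wE wVH wΛ)
open Summit.QuantumFields.BalabanUV.Beta.HessKerDressedUnits (unitK unitS)
open Summit.QuantumFields.BalabanUV.Beta.SecondOrderUnits (mmRead_unitK)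
open Summit.QuantumFields.BalabanUV.Beta.GAN24.CombesThomas (sfStep smStep sfStep_ne_zero smStep_ne_zero KStepUnit)
open Summit.QuantumFields.BalabanUV.Beta.GAN24.ThirdJetKernel (e3K)
open Summit.QuantumFields.BalabanUV.Beta.GAN24.StencilSlotLam (unitS_smul_ffOnly SLam_smul SLam_entry_zero lamCoeffK_unit lam_unit_factor E2_inr)
open Summit.QuantumFields.BalabanUV.Beta.GAN24.StencilSlotVH (unitS_smul_offDiag vh_unit_factor)
open Summit.QuantumFields.BalabanUV.Beta.GAN24.StencilSlotOfShapes (unitS_add)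
open Summit.QuantumFields.BalabanUV.Beta.GAN24.SrecUnits (unitS_cubicPiece_eq)
open Summit.QuantumFields.BalabanUV.Beta.GAN24.CubicReadoutDecLift (e3OfK_eq_e3K)
open Summit.QuantumFields.BalabanUV.Beta.SpineRooted (e3OfK)
open Summit.QuantumFields.BalabanUV.Beta.WardLocusRecursive (SrecOf SrecOf_succ)
open Summit.QuantumFields.BalabanUV.Beta.SymmetrisedStepJets (SymTables Gsym SsymOf)

namespace Summit.QuantumFields.BalabanUV.Beta.FP.PerfectStencilStep

variable {d : ℕ} {Lc : ℕ} [NeZero Lc]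

/-! ## §1 Block shape of `S^Λ` over a field–field table; the value Hessian in units -/

section Shapes

variable {H : Fin (d + 1) → (Fin (d + 1) → ℤ) → MKer (d + 1) (Fib d)}

/-- [folklore] (ShH) ⟹ `S^Λ` over `H` vanishes on the `(inl, inr)` block. -/
theorem SLam_offFF_inl_inr (hHfm : ∀ μ y x z (α ν : Fin (d + 1)), H μ y x z (Sum.inl α) (Sum.inr ν) = 0)
    (c : Fin (d + 1) → (Fin (d + 1) → ℤ) → Fin (d + 1) → (Fin (d + 1) → ℤ) → ℝ) (κ : Fin (d + 1)) (u x z : Fin (d + 1) → ℤ) (α ν : Fin (d + 1)) :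
    SLam Lc c H κ u x z (Sum.inl α) (Sum.inr ν) = 0 :=
  SLam_entry_zero c (fun μ y => hHfm μ y x z α ν) κ u

/-- [folklore] (ShH) ⟹ `S^Λ` over `H` vanishes on the multiplier rows. -/
theorem SLam_offFF_inr (hHm : ∀ μ y x z (ν : Fin (d + 1)) (b : Fib d), H μ y x z (Sum.inr ν) b = 0)
    (c : Fin (d + 1) → (Fin (d + 1) → ℤ) → Fin (d + 1) → (Fin (d + 1) → ℤ) → ℝ) (κ : Fin (d + 1)) (u x z : Fin (d + 1) → ℤ) (ν : Fin (d + 1))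
    (b : Fib d) : SLam Lc c H κ u x z (Sum.inr ν) b = 0 :=
  SLam_entry_zero c (fun μ y => hHm μ y x z ν b) κ u

end Shapes

/-- [folklore] **THE VALUE HESSIAN IN UNITS IS THE `mm`-READ OF THE UNIT STEP RESOLVENT**: `(s_m j)² • E2 d Lc (j+1) = mmRead Lc (KStepUnit Lc j)`
(an2's `BalabanStepW2.E2_succ_eq` + an4's `SecondOrderUnits.mmRead_unitK`). -/
theorem smul_E2_succ_eq_mmRead_KStepUnit (j : ℕ) :
    (smStep d Lc j) ^ 2 • E2 d Lc (j + 1) = mmRead Lc (KStepUnit (d := d) Lc j) := by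
  rw [show KStepUnit (d := d) Lc j = unitK (sfStep Lc j) (smStep d Lc j) (KInvStep (d := d) Lc j) from rfl, mmRead_unitK,
    BalabanStepW2.E2_succ_eq, pow_two]

/-! ## §2 The three slotted summands of member `j + 1` in the units of level `j + 1` -/

section Pieces

variable (V H : Fin (d + 1) → (Fin (d + 1) → ℤ) → MKer (d + 1) (Fib d))

/-- [folklore] **THE BORDER SLOT** ((ShV)): `unitS_{j+1} ((cVH·wVH (j+1)) • V) = cVH • V` — NO power of `Lc` survives (`StencilSlotVH.vh_unit_factor`). -/
theorem unitS_borderSlot_eq (hVff : ∀ κ u x y (α β : Fin (d + 1)), V κ u x y (Sum.inl α) (Sum.inl β) = 0)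
    (hVmm : ∀ κ u x y (μ ν : Fin (d + 1)), V κ u x y (Sum.inr μ) (Sum.inr ν) = 0) (cVH : ℝ) (j : ℕ) :
    unitS (sfStep Lc (j + 1)) (smStep d Lc (j + 1)) (fun κ u => (cVH * wVH d Lc (j + 1)) • V κ u) = fun κ u => cVH • V κ u := by
  rw [unitS_smul_offDiag _ _ _ V hVff hVmm]
  have h : (sfStep Lc (j + 1) * smStep d Lc (j + 1))⁻¹ * ((sfStep Lc (j + 1))⁻¹ * (smStep d Lc (j + 1))⁻¹) * (cVH * wVH d Lc (j + 1)) = cVH := by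
    calc (sfStep Lc (j + 1) * smStep d Lc (j + 1))⁻¹ * ((sfStep Lc (j + 1))⁻¹ * (smStep d Lc (j + 1))⁻¹) * (cVH * wVH d Lc (j + 1))
        = cVH * ((sfStep Lc (j + 1) * smStep d Lc (j + 1))⁻¹ * ((sfStep Lc (j + 1))⁻¹ * (smStep d Lc (j + 1))⁻¹) * wVH d Lc (j + 1)) := by ring
      _ = cVH := by rw [vh_unit_factor (d := d) (Lc := Lc) (j + 1), mul_one]
  rw [h]

/-- [folklore] **THE CUBIC SLOT**: `unitS_{j+1} ((cE·wE (j+1)) • e3OfK Lc G S) = (cE·Lc^{2(d+1)}) • e3OfK Lc (unitK_j G) (unitS_j S)` — gan24-p1's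
`SrecUnits.unitS_cubicPiece_eq` read through `CubicReadoutDecLift.e3OfK_eq_e3K` (`e3OfK L K S = e3K K L S`, `rfl`). -/
theorem unitS_cubicSlot_eq (cE : ℝ) (j : ℕ) (G : MKer (d + 1) (Fib d)) (S : Fin (d + 1) → (Fin (d + 1) → ℤ) → MKer (d + 1) (Fib d)) :
    unitS (sfStep Lc (j + 1)) (smStep d Lc (j + 1)) (fun κ u => (cE * wE d Lc (j + 1)) • e3OfK Lc G S κ u)
      = fun κ u => (cE * (Lc : ℝ) ^ (2 * (d + 1))) • e3OfK Lc (unitK (sfStep Lc j) (smStep d Lc j) G) (unitS (sfStep Lc j) (smStep d Lc j) S) κ u :=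
  unitS_cubicPiece_eq cE j G S

/-- [folklore] **THE LAGRANGE SLOT** ((ShH)): `unitS_{j+1} ((cΛ·wΛ (j+1)) • SLam Lc (lamCoeffK (KInvStep Lc (j+1)) (E2 d Lc (j+1)) Lc) H)
= (cΛ·Lc^{2(d+1)}) • SLam Lc (lamCoeffK (KStepUnit Lc (j+1)) (mmRead Lc (KStepUnit Lc j)) Lc) H` — gan24-p1's `StencilSlotLam.unitS_lamPiece_eq` with the
Hessian table SLOTTED, then §1's dictionary for the value Hessian. -/
theorem unitS_lamSlot_eq (hHfm : ∀ μ y x z (α ν : Fin (d + 1)), H μ y x z (Sum.inl α) (Sum.inr ν) = 0)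
    (hHm : ∀ μ y x z (ν : Fin (d + 1)) (b : Fib d), H μ y x z (Sum.inr ν) b = 0) (cΛ : ℝ) (j : ℕ) :
    unitS (sfStep Lc (j + 1)) (smStep d Lc (j + 1))
        (fun κ u => (cΛ * wΛ d Lc (j + 1)) • SLam Lc (lamCoeffK (KInvStep (d := d) Lc (j + 1)) (E2 d Lc (j + 1)) Lc) H κ u)
      = fun κ u => (cΛ * (Lc : ℝ) ^ (2 * (d + 1))) •
          SLam Lc (lamCoeffK (KStepUnit (d := d) Lc (j + 1)) (mmRead Lc (KStepUnit (d := d) Lc j)) Lc) H κ u := by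
  have hsf : sfStep Lc (j + 1) ≠ 0 := sfStep_ne_zero (j + 1)
  have hsm : smStep d Lc (j + 1) ≠ 0 := smStep_ne_zero (d := d) (j + 1)
  have ht : (smStep d Lc j) ^ 2 ≠ 0 := pow_ne_zero 2 (smStep_ne_zero (d := d) j)
  -- the coefficients through the rescaled factors (an2's `lamCoeffK_unit`, `E2` has no multiplier rows)
  have hc : lamCoeffK (KInvStep (d := d) Lc (j + 1)) (E2 d Lc (j + 1)) Lc = fun μ y κ u =>
      ((smStep d Lc (j + 1) * sfStep Lc (j + 1))⁻¹ * ((smStep d Lc j) ^ 2)⁻¹) *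
        lamCoeffK (KStepUnit (d := d) Lc (j + 1)) ((smStep d Lc j) ^ 2 • E2 d Lc (j + 1)) Lc μ y κ u := by
    funext μ y κ u
    exact lamCoeffK_unit hsf hsm ht _ _ (fun y z ν b => E2_inr (j + 1) y z ν b) Lc μ y κ u
  rw [hc, SLam_smul, smul_E2_succ_eq_mmRead_KStepUnit]
  have hfun : (fun κ u => (cΛ * wΛ d Lc (j + 1)) •
      (fun κ u => ((smStep d Lc (j + 1) * sfStep Lc (j + 1))⁻¹ * ((smStep d Lc j) ^ 2)⁻¹) •
        SLam Lc (lamCoeffK (KStepUnit (d := d) Lc (j + 1)) (mmRead Lc (KStepUnit (d := d) Lc j)) Lc) H κ u) κ u)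
      = fun κ u => ((cΛ * wΛ d Lc (j + 1)) * (((smStep d Lc (j + 1) * sfStep Lc (j + 1))⁻¹ * ((smStep d Lc j) ^ 2)⁻¹))) •
        SLam Lc (lamCoeffK (KStepUnit (d := d) Lc (j + 1)) (mmRead Lc (KStepUnit (d := d) Lc j)) Lc) H κ u := by
    funext κ u
    rw [smul_smul]
  rw [hfun, unitS_smul_ffOnly _ _ _ _ (fun κ u x y α ν => SLam_offFF_inl_inr hHfm _ κ u x y α ν)
    (fun κ u x y ν α => SLam_offFF_inr hHm _ κ u x y ν (Sum.inl α)) (fun κ u x y ν ν' => SLam_offFF_inr hHm _ κ u x y ν (Sum.inr ν'))]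
  funext κ u
  congr 1
  rw [← mul_assoc]
  exact lam_unit_factor cΛ j

end Pieces

/-! ## §3 The rescaled step is `j`-independent -/

section Step

variable (V H : Fin (d + 1) → (Fin (d + 1) → ℤ) → MKer (d + 1) (Fib d)) (G : ℕ → MKer (d + 1) (Fib d)) (cE cVH cΛ : ℝ)

/-- [folklore] **THE RESCALED RECURSION STEP OF `SrecOf` IS `j`-INDEPENDENT** (mod (ShV)(ShH)): in the adopted units of levels `j + 1` resp. `j`,
`S̃_{j+1} = (cE·Lc^{2(d+1)}) • e3OfK Lc G̃_j S̃_j + cVH • V + (cΛ·Lc^{2(d+1)}) • S^Λ[lamCoeffK K̃_{j+1} (mmRead Lc K̃_j)] H` with `S̃_j := unitS_j (SrecOf … j)`,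
`G̃_j := unitK_j (G j)`, `K̃_j := KStepUnit Lc j` — every power of `Lc^j` has cancelled; the weights are those of GAN24's READING paragraph (`SrecUnits`). -/
theorem unitS_SrecOf_succ (hVff : ∀ κ u x y (α β : Fin (d + 1)), V κ u x y (Sum.inl α) (Sum.inl β) = 0)
    (hVmm : ∀ κ u x y (μ ν : Fin (d + 1)), V κ u x y (Sum.inr μ) (Sum.inr ν) = 0)
    (hHfm : ∀ μ y x z (α ν : Fin (d + 1)), H μ y x z (Sum.inl α) (Sum.inr ν) = 0)
    (hHm : ∀ μ y x z (ν : Fin (d + 1)) (b : Fib d), H μ y x z (Sum.inr ν) b = 0) (j : ℕ) :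
    unitS (sfStep Lc (j + 1)) (smStep d Lc (j + 1)) (SrecOf d Lc V H G cE cVH cΛ (j + 1)) = fun κ u =>
      (cE * (Lc : ℝ) ^ (2 * (d + 1))) •
          e3OfK Lc (unitK (sfStep Lc j) (smStep d Lc j) (G j)) (unitS (sfStep Lc j) (smStep d Lc j) (SrecOf d Lc V H G cE cVH cΛ j)) κ u +
        cVH • V κ u +
        (cΛ * (Lc : ℝ) ^ (2 * (d + 1))) • SLam Lc (lamCoeffK (KStepUnit (d := d) Lc (j + 1)) (mmRead Lc (KStepUnit (d := d) Lc j)) Lc) H κ u := by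
  rw [SrecOf_succ]
  have hsplit : (fun κ' u' =>
      (cE * wE d Lc (j + 1)) • e3OfK Lc (G j) (SrecOf d Lc V H G cE cVH cΛ j) κ' u' + (cVH * wVH d Lc (j + 1)) • V κ' u' +
        (cΛ * wΛ d Lc (j + 1)) • SLam Lc (lamCoeffK (KInvStep (d := d) Lc (j + 1)) (E2 d Lc (j + 1)) Lc) H κ' u')
      = fun κ' u' => (fun κ u => (cE * wE d Lc (j + 1)) • e3OfK Lc (G j) (SrecOf d Lc V H G cE cVH cΛ j) κ u + (cVH * wVH d Lc (j + 1)) • V κ u) κ' u' +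
          (fun κ u => (cΛ * wΛ d Lc (j + 1)) • SLam Lc (lamCoeffK (KInvStep (d := d) Lc (j + 1)) (E2 d Lc (j + 1)) Lc) H κ u) κ' u' := rfl
  rw [hsplit, unitS_add, unitS_add, unitS_cubicSlot_eq cE j (G j), unitS_borderSlot_eq V hVff hVmm cVH j, unitS_lamSlot_eq H hHfm hHm cΛ j]

end Step

/-! ## §4 The instance for the (0.4) literal's slotted family `SsymOf` -/

section Literal

variable (tabs : SymTables d Lc) (cE cVH cΛ : ℝ)

/-- [folklore] **THE LITERAL'S RESCALED STEP** (`SsymOf tabs cE cVH cΛ = SrecOf d Lc tabs.V tabs.H (Gsym Lc) cE cVH cΛ`, by definition): with the block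
shapes (ShV)(ShH) of `tabs.V`, `tabs.H` displayed, the step in the adopted units is the `j`-free map of §3 over `unitK_j (Gsym Lc j)` and `KStepUnit`. -/
theorem unitS_SsymOf_succ (hVff : ∀ κ u x y (α β : Fin (d + 1)), tabs.V κ u x y (Sum.inl α) (Sum.inl β) = 0)
    (hVmm : ∀ κ u x y (μ ν : Fin (d + 1)), tabs.V κ u x y (Sum.inr μ) (Sum.inr ν) = 0)
    (hHfm : ∀ μ y x z (α ν : Fin (d + 1)), tabs.H μ y x z (Sum.inl α) (Sum.inr ν) = 0)
    (hHm : ∀ μ y x z (ν : Fin (d + 1)) (b : Fib d), tabs.H μ y x z (Sum.inr ν) b = 0) (j : ℕ) :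
    unitS (sfStep Lc (j + 1)) (smStep d Lc (j + 1)) (SsymOf tabs cE cVH cΛ (j + 1)) = fun κ u =>
      (cE * (Lc : ℝ) ^ (2 * (d + 1))) •
          e3OfK Lc (unitK (sfStep Lc j) (smStep d Lc j) (Gsym Lc j)) (unitS (sfStep Lc j) (smStep d Lc j) (SsymOf tabs cE cVH cΛ j)) κ u +
        cVH • tabs.V κ u +
        (cΛ * (Lc : ℝ) ^ (2 * (d + 1))) • SLam Lc (lamCoeffK (KStepUnit (d := d) Lc (j + 1)) (mmRead Lc (KStepUnit (d := d) Lc j)) Lc) tabs.H κ u :=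
  unitS_SrecOf_succ tabs.V tabs.H (Gsym Lc) cE cVH cΛ hVff hVmm hHfm hHm j

end Literal

end Summit.QuantumFields.BalabanUV.Beta.FP.PerfectStencilStep

end
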